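import Literature.RingTheory.MvPolynomial.RefinedBezoutCount
import Literature.RingTheory.MvPolynomial.BihomogeneousCoefficients
import Mathlib.RingTheory.Nullstellensatz
import Mathlib.RingTheory.KrullDimension.Polynomial
import Mathlib.RingTheory.KrullDimension.Field
import HarnessLib

/-!
# Refined Bézout counting, geometric form: isolated projective zeros of `g = 0, b = 0 (b ∈ B)`
# number at most `deg g · D^{m-2}`

Topic: `Literature/RingTheory/MvPolynomial`. The point-set companion of
`Literature.RingTheory.MvPolynomial.card_le_mul_pow_of_minimalPrimes` (`RefinedBezoutCount.lean`):
over an algebraically closed field `K`, let `g ≠ 0` be a form of degree `e ≥ 1` in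
`S = K[X_0, …, X_{m-1}]` (`m ≥ 2`) and `B` a set of forms of degree `≤ D` (`D ≥ 1`). If `T` is a
finite set of non-zero, pairwise non-proportional common zeros of `g` and `B`, each of which is
ISOLATED in the sense that some polynomial `F` with `F(x) ≠ 0` has
`V(g, B) ∩ {F ≠ 0} ⊆ ⋃_{z ∈ T} K·z`, then **`|T| ≤ e · D^{m-2}`**
(`card_le_mul_pow_of_isolated`): the number of isolated points of `V(g) ∩ V(B) ⊂ ℙ^{m-1}` is at
most `e D^{m-2}`, whatever the positive-dimensional part of the intersection (refined Bézout
theorem, Fulton, *Intersection Theory*, Ex. 8.4.6 / Ex. 12.3.1; Heintz 1983 Thm. 1).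

The bridge from points to the ideal-theoretic count is the **homogeneous ideal of the line `K·x`**,
realised as the kernel `𝔭_x` of the substitution `X_i ↦ x_i T`, `S → K[T]`
(`MvPolynomial.eval₂Hom Polynomial.C (fun i => Polynomial.C (x i) * Polynomial.X)`):
* `polynomial_eval_lineSubst`, `mem_ker_lineSubst_iff` — `p ∈ 𝔭_x ↔ p(t x) = 0` for all `t`;
  `mem_ker_lineSubst_of_isHomogeneous` — a form vanishing at `x` lies in `𝔭_x`;
* `lineSubst_surjective`, `ringKrullDim_quotient_ker_lineSubst` — for `x ≠ 0`, `S/𝔭_x ≅ K[T]`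
  has Krull dimension `1` (`𝔭_x` is a "point of `ℙ^{m-1}`");
* `exists_eq_smul_of_forall_mem_ker_lineSubst` — the zero set of `𝔭_x` is the line `K·x`;
* **`ker_lineSubst_mem_minimalPrimes_of_isolated`** — if `x ≠ 0` is an isolated zero (as
  above) of an ideal `𝔞` generated by forms vanishing at `x`, then `𝔭_x` is a minimal prime of
  `𝔞` (a smaller prime `𝔮` has `dim S/𝔮 ≥ 2`; by Hilbert's Nullstellensatz — Mathlib
  `MvPolynomial.IsPrime.vanishingIdeal_zeroLocus` — the product of `F` and of one element of each
  `𝔭_z ∖ 𝔮` would lie in `𝔮`).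

## References

* W. Fulton, *Intersection Theory*, 2nd ed., Springer 1998, Example 8.4.6, Example 12.3.1.
  [Fulton1998]
* J. Heintz, *Definability and fast quantifier elimination in algebraically closed fields*,
  Theoret. Comput. Sci. 24 (1983) 239–277, Thm. 1. [Heintz1983]
-/

noncomputable section

open MvPolynomial

namespace Literature.RingTheory.MvPolynomial

variable {K : Type*} [Field K] {m : ℕ}

/-! ## The line substitution `X_i ↦ x_i T` and its kernel -/

/-- `p(x_0 T, …, x_{m-1} T)` evaluated at `T = t` is `p(t x)`. [folklore] -/
theorem polynomial_eval_lineSubst (x : Fin m → K) (p : MvPolynomial (Fin m) K) (t : K) :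
    Polynomial.eval t
        (MvPolynomial.eval₂Hom Polynomial.C (fun i : Fin m => Polynomial.C (x i) * Polynomial.X) p) =
      MvPolynomial.eval (t • x) p := by
  induction p using MvPolynomial.induction_on with
  | C a => simp
  | add p q hp hq => simp only [map_add, Polynomial.eval_add, hp, hq]
  | mul_X p i hp =>
    simp only [map_mul, Polynomial.eval_mul, hp, MvPolynomial.eval₂Hom_X', MvPolynomial.eval_X,
      Polynomial.eval_C, Polynomial.eval_X, Pi.smul_apply, smul_eq_mul]
    ring

/-- An element of the kernel of the line substitution vanishes on the line `K·x`. [folklore] -/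
theorem eval_smul_eq_zero_of_mem_ker_lineSubst {x : Fin m → K} {p : MvPolynomial (Fin m) K}
    (hp : p ∈ RingHom.ker
      (MvPolynomial.eval₂Hom Polynomial.C (fun i : Fin m => Polynomial.C (x i) * Polynomial.X)))
    (t : K) : MvPolynomial.eval (t • x) p = 0 := by
  rw [RingHom.mem_ker] at hp
  rw [← polynomial_eval_lineSubst, hp, Polynomial.eval_zero]

/-- Over an infinite field, **`p ∈ 𝔭_x ↔ p` vanishes on the line `K·x`**. [folklore] -/
theorem mem_ker_lineSubst_iff [Infinite K] {x : Fin m → K} {p : MvPolynomial (Fin m) K} :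
    p ∈ RingHom.ker
        (MvPolynomial.eval₂Hom Polynomial.C (fun i : Fin m => Polynomial.C (x i) * Polynomial.X)) ↔
      ∀ t : K, MvPolynomial.eval (t • x) p = 0 := by
  refine ⟨fun hp t => eval_smul_eq_zero_of_mem_ker_lineSubst hp t, fun h => ?_⟩
  rw [RingHom.mem_ker]
  refine Polynomial.funext fun t => ?_
  rw [polynomial_eval_lineSubst, h t, Polynomial.eval_zero]

/-- **A form vanishing at `x` vanishes on the line `K·x`**, hence lies in `𝔭_x`. [folklore] -/
theorem mem_ker_lineSubst_of_isHomogeneous [Infinite K] {x : Fin m → K}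
    {p : MvPolynomial (Fin m) K} {k : ℕ} (hp : p.IsHomogeneous k) (hx : MvPolynomial.eval x p = 0) :
    p ∈ RingHom.ker
      (MvPolynomial.eval₂Hom Polynomial.C (fun i : Fin m => Polynomial.C (x i) * Polynomial.X)) := by
  rw [mem_ker_lineSubst_iff]
  intro t
  rw [eval_smul_of_isHomogeneous hp, hx, mul_zero]

/-- The elements `x_j X_i - x_i X_j` lie in `𝔭_x`. [folklore] -/
theorem C_mul_X_sub_mem_ker_lineSubst (x : Fin m → K) (i j : Fin m) :
    (C (x j) * X i - C (x i) * X j : MvPolynomial (Fin m) K) ∈ RingHom.ker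
      (MvPolynomial.eval₂Hom Polynomial.C (fun i : Fin m => Polynomial.C (x i) * Polynomial.X)) := by
  rw [RingHom.mem_ker]
  simp only [map_sub, map_mul, MvPolynomial.eval₂Hom_C, MvPolynomial.eval₂Hom_X']
  ring

/-- **The zero set of `𝔭_x` is the line `K·x`** (`x ≠ 0`): a common zero of the elements
`x_j X_{i₀} - x_{i₀} X_j` (`x_{i₀} ≠ 0`) is proportional to `x`. [folklore] -/
theorem exists_eq_smul_of_forall_mem_ker_lineSubst {x : Fin m → K} (hx : x ≠ 0) {y : Fin m → K}
    (hy : ∀ p ∈ RingHom.ker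
      (MvPolynomial.eval₂Hom Polynomial.C (fun i : Fin m => Polynomial.C (x i) * Polynomial.X)),
      MvPolynomial.eval y p = 0) :
    ∃ t : K, y = t • x := by
  obtain ⟨i₀, hi₀⟩ : ∃ i₀, x i₀ ≠ 0 := by
    by_contra h
    push Not at h
    exact hx (funext h)
  refine ⟨y i₀ * (x i₀)⁻¹, funext fun j => ?_⟩
  have h := hy _ (C_mul_X_sub_mem_ker_lineSubst x i₀ j)
  simp only [map_sub, map_mul, MvPolynomial.eval_C, MvPolynomial.eval_X] at h
  rw [Pi.smul_apply, smul_eq_mul]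
  have h' : x i₀ * y j = y i₀ * x j := by linear_combination -h
  calc y j = (x i₀)⁻¹ * (x i₀ * y j) := by rw [← mul_assoc, inv_mul_cancel₀ hi₀, one_mul]
    _ = y i₀ * (x i₀)⁻¹ * x j := by rw [h']; ring

/-- **The line substitution is onto `K[T]`** when `x ≠ 0` (`T` is the image of
`x_{i₀}⁻¹ X_{i₀}`). [folklore] -/
theorem lineSubst_surjective {x : Fin m → K} (hx : x ≠ 0) :
    Function.Surjective
      (MvPolynomial.eval₂Hom Polynomial.C (fun i : Fin m => Polynomial.C (x i) * Polynomial.X)) := by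
  obtain ⟨i₀, hi₀⟩ : ∃ i₀, x i₀ ≠ 0 := by
    by_contra h
    push Not at h
    exact hx (funext h)
  set ψ := MvPolynomial.eval₂Hom Polynomial.C (fun i : Fin m => Polynomial.C (x i) * Polynomial.X)
    with hψ
  have hX : ψ (C (x i₀)⁻¹ * X i₀) = Polynomial.X := by
    simp only [hψ, map_mul, MvPolynomial.eval₂Hom_C, MvPolynomial.eval₂Hom_X']
    rw [← mul_assoc, ← Polynomial.C_mul, inv_mul_cancel₀ hi₀, Polynomial.C_1, one_mul]
  intro q
  refine ⟨Polynomial.eval₂ MvPolynomial.C (C (x i₀)⁻¹ * X i₀) q, ?_⟩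
  rw [Polynomial.hom_eval₂, hX]
  have hC : ψ.comp MvPolynomial.C = Polynomial.C := by
    ext a
    simp [hψ]
  rw [hC, Polynomial.eval₂_C_X]

/-- **`dim S/𝔭_x = 1`** for `x ≠ 0`: `S/𝔭_x ≅ K[T]`. [folklore] -/
theorem ringKrullDim_quotient_ker_lineSubst {x : Fin m → K} (hx : x ≠ 0) :
    ringKrullDim (MvPolynomial (Fin m) K ⧸ (RingHom.ker
      (MvPolynomial.eval₂Hom Polynomial.C (fun i : Fin m => Polynomial.C (x i) * Polynomial.X)) :
        Ideal (MvPolynomial (Fin m) K))) = (1 : ℕ) := by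
  rw [ringKrullDim_eq_of_ringEquiv (RingHom.quotientKerEquivOfSurjective (lineSubst_surjective hx)),
    Polynomial.ringKrullDim_of_isNoetherianRing, ringKrullDim_eq_zero_of_field K, zero_add,
    Nat.cast_one]

/-- The kernel `𝔭_x` is a prime ideal. [folklore] -/
theorem ker_lineSubst_isPrime (x : Fin m → K) :
    (RingHom.ker (MvPolynomial.eval₂Hom Polynomial.C
      (fun i : Fin m => Polynomial.C (x i) * Polynomial.X))).IsPrime :=
  RingHom.ker_isPrime _

/-- **Distinct lines have distinct ideals**: `𝔭_x = 𝔭_{x'}` with `x ≠ 0` forces `x' ∈ K·x`.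
[folklore] -/
theorem exists_eq_smul_of_ker_lineSubst_eq {x x' : Fin m → K} (hx : x ≠ 0)
    (h : RingHom.ker (MvPolynomial.eval₂Hom Polynomial.C
        (fun i : Fin m => Polynomial.C (x i) * Polynomial.X)) =
      RingHom.ker (MvPolynomial.eval₂Hom Polynomial.C
        (fun i : Fin m => Polynomial.C (x' i) * Polynomial.X))) :
    ∃ t : K, x' = t • x := by
  refine exists_eq_smul_of_forall_mem_ker_lineSubst hx fun p hp => ?_
  rw [h] at hp
  simpa using eval_smul_eq_zero_of_mem_ker_lineSubst hp 1

/-! ## Isolated zeros give minimal primes -/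

/-- **An isolated projective zero is a minimal prime.** Let `K` be algebraically closed,
`𝔞 = (G)` an ideal of `S = K[X_0, …, X_{m-1}]` generated by forms all vanishing at `x ≠ 0`, and
suppose `x` is isolated among the zeros of `G` in the following sense: for some polynomial `F`
with `F(x) ≠ 0`, every common zero `y` of `G` with `F(y) ≠ 0` lies on one of finitely many lines
`K·z`, `z ∈ T`, `z ≠ 0`. Then the ideal `𝔭_x` of the line `K·x` is a minimal prime of `𝔞`.
(A prime `𝔮 ⊊ 𝔭_x` over `𝔞` has `dim S/𝔮 ≥ 2`, so contains no `𝔭_z`; the product of `F` and of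
elements of `𝔭_z ∖ 𝔮` vanishes on `V(𝔮)`, hence lies in `𝔮` by the Nullstellensatz — a
contradiction.) [cite: Fulton1998, Example 12.3.1] -/
theorem ker_lineSubst_mem_minimalPrimes_of_isolated [IsAlgClosed K] {x : Fin m → K} (hx : x ≠ 0)
    {G : Set (MvPolynomial (Fin m) K)} (hG : ∀ p ∈ G, ∃ k, p.IsHomogeneous k)
    (hGx : ∀ p ∈ G, MvPolynomial.eval x p = 0) {F : MvPolynomial (Fin m) K}
    (hFx : MvPolynomial.eval x F ≠ 0) (T : Finset (Fin m → K)) (hT0 : ∀ z ∈ T, z ≠ 0)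
    (hiso : ∀ y : Fin m → K, (∀ p ∈ G, MvPolynomial.eval y p = 0) → MvPolynomial.eval y F ≠ 0 →
      ∃ z ∈ T, ∃ t : K, y = t • z) :
    RingHom.ker (MvPolynomial.eval₂Hom Polynomial.C
        (fun i : Fin m => Polynomial.C (x i) * Polynomial.X)) ∈ (Ideal.span G).minimalPrimes := by
  classical
  set 𝔭 : (Fin m → K) → Ideal (MvPolynomial (Fin m) K) := fun z => RingHom.ker
    (MvPolynomial.eval₂Hom Polynomial.C (fun i : Fin m => Polynomial.C (z i) * Polynomial.X))
    with h𝔭def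
  change 𝔭 x ∈ (Ideal.span G).minimalPrimes
  haveI h𝔭xprime : (𝔭 x).IsPrime := ker_lineSubst_isPrime x
  have h𝔞le : Ideal.span G ≤ 𝔭 x := by
    rw [Ideal.span_le]
    intro p hp
    obtain ⟨k, hk⟩ := hG p hp
    exact mem_ker_lineSubst_of_isHomogeneous hk (hGx p hp)
  obtain ⟨𝔮, h𝔮min, h𝔮le⟩ := Ideal.exists_minimalPrimes_le h𝔞le
  haveI h𝔮prime : 𝔮.IsPrime := h𝔮min.1.1
  suffices h : 𝔮 = 𝔭 x by rwa [← h]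
  by_contra hne
  have hnot : ¬ 𝔭 x ≤ 𝔮 := fun h => hne (le_antisymm h𝔮le h)
  -- `dim S/𝔮 ≥ 2`
  obtain ⟨n, hn, -⟩ := exists_nat_ringKrullDim_quotient_eq (K := K) h𝔮prime.ne_top
  have hlt := ringKrullDim_quotient_sup_lt_of_not_le hn hnot
  rw [sup_eq_right.mpr h𝔮le, ringKrullDim_quotient_ker_lineSubst hx] at hlt
  have hn2 : 2 ≤ n := by
    have : (1 : ℕ) < n := by exact_mod_cast hlt
    omega
  -- no `𝔭_z` lies below `𝔮`
  have hnotz : ∀ z ∈ T, ¬ 𝔭 z ≤ 𝔮 := by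
    intro z hz hle
    haveI : (𝔭 z).IsPrime := ker_lineSubst_isPrime z
    have hdim : ringKrullDim (MvPolynomial (Fin m) K ⧸ 𝔮) ≤
        ringKrullDim (MvPolynomial (Fin m) K ⧸ 𝔭 z) :=
      ringKrullDim_le_of_surjective (Ideal.Quotient.factor hle) (Ideal.Quotient.factor_surjective _)
    rw [hn, h𝔭def, ringKrullDim_quotient_ker_lineSubst (hT0 z hz)] at hdim
    have : n ≤ 1 := by exact_mod_cast hdim
    omega
  have hsel : ∀ z ∈ T, ∃ q : MvPolynomial (Fin m) K, q ∈ 𝔭 z ∧ q ∉ 𝔮 := by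
    intro z hz
    by_contra h
    push Not at h
    exact hnotz z hz fun q hq => h q hq
  choose! sel hsel𝔭 hsel𝔮 using hsel
  -- `F · ∏ sel z` vanishes on `V(𝔮)` but is not in `𝔮`
  have hF𝔮 : F ∉ 𝔮 := fun hF => hFx (by
    simpa using eval_smul_eq_zero_of_mem_ker_lineSubst (h𝔮le hF) 1)
  have hprod : F * ∏ z ∈ T, sel z ∉ 𝔮 := by
    intro h
    rcases h𝔮prime.mem_or_mem h with hF | hP
    · exact hF𝔮 hF
    · obtain ⟨z, hz, hz𝔮⟩ := Ideal.IsPrime.prod_mem_iff.mp hP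
      exact hsel𝔮 z hz hz𝔮
  apply hprod
  rw [← MvPolynomial.IsPrime.vanishingIdeal_zeroLocus (K := K) 𝔮, MvPolynomial.mem_vanishingIdeal_iff]
  intro y hy
  rw [MvPolynomial.mem_zeroLocus_iff] at hy
  simp only [MvPolynomial.aeval_eq_eval] at hy ⊢
  rw [map_mul, map_prod]
  by_cases hFy : MvPolynomial.eval y F = 0
  · rw [hFy, zero_mul]
  · obtain ⟨z, hz, t, rfl⟩ := hiso y (fun p hp => hy p (h𝔮min.1.2 (Ideal.subset_span hp))) hFy
    rw [Finset.prod_eq_zero hz (eval_smul_eq_zero_of_mem_ker_lineSubst (hsel𝔭 z hz) t), mul_zero]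

/-! ## The count -/

/-- **Refined Bézout count of isolated projective zeros** (Fulton, *Intersection Theory*,
Ex. 8.4.6 / 12.3.1, count form; Heintz 1983 Thm. 1): let `K` be algebraically closed,
`S = K[X_0, …, X_{m-1}]` with `m ≥ 2`, `g ≠ 0` a form of degree `e ≥ 1`, `B` a set of forms of
degree `≤ D` (`D ≥ 1`), and `T` a finite set of non-zero, pairwise non-proportional common zeros
of `g` and `B` each of which is isolated: for every `x ∈ T` some polynomial `F` with `F(x) ≠ 0`
has all common zeros `y` of `g, B` with `F(y) ≠ 0` on the lines `K·z`, `z ∈ T`. Then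
`|T| ≤ e · D^{m-2}`. Positive-dimensional components of `V(g) ∩ V(B)` are allowed.
[cite: Fulton1998, Example 8.4.6] -/
theorem card_le_mul_pow_of_isolated [IsAlgClosed K] {e D : ℕ} (he : 1 ≤ e) (hD : 1 ≤ D)
    (hm : 2 ≤ m) {g : MvPolynomial (Fin m) K} (hg0 : g ≠ 0) (hg : g.IsHomogeneous e)
    {B : Set (MvPolynomial (Fin m) K)} (hBdeg : ∀ b ∈ B, ∃ k, k ≤ D ∧ b.IsHomogeneous k)
    (T : Finset (Fin m → K)) (hT0 : ∀ x ∈ T, x ≠ 0)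
    (hTline : ∀ x ∈ T, ∀ x' ∈ T, ∀ t : K, x' = t • x → x' = x)
    (hTg : ∀ x ∈ T, MvPolynomial.eval x g = 0) (hTB : ∀ x ∈ T, ∀ b ∈ B, MvPolynomial.eval x b = 0)
    (hiso : ∀ x ∈ T, ∃ F : MvPolynomial (Fin m) K, MvPolynomial.eval x F ≠ 0 ∧
      ∀ y : Fin m → K, MvPolynomial.eval y g = 0 → (∀ b ∈ B, MvPolynomial.eval y b = 0) →
        MvPolynomial.eval y F ≠ 0 → ∃ z ∈ T, ∃ t : K, y = t • z) :
    T.card ≤ e * D ^ (m - 2) := by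
  classical
  set 𝔭 : (Fin m → K) → Ideal (MvPolynomial (Fin m) K) := fun z => RingHom.ker
    (MvPolynomial.eval₂Hom Polynomial.C (fun i : Fin m => Polynomial.C (z i) * Polynomial.X))
    with h𝔭def
  -- `x ↦ 𝔭_x` is injective on `T`
  have hinj : Set.InjOn 𝔭 T := by
    intro x hx x' hx' h
    obtain ⟨t, ht⟩ := exists_eq_smul_of_ker_lineSubst_eq (hT0 x hx) h
    exact (hTline x hx x' hx' t ht).symm
  rw [← Finset.card_image_of_injOn hinj]
  -- every `𝔭_x` is a minimal prime of `𝔞 = (g, B)` of dimension `1`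
  have hG : ∀ p ∈ insert g B, ∃ k, p.IsHomogeneous k := by
    rintro p (rfl | hp)
    · exact ⟨e, hg⟩
    · obtain ⟨k, -, hk⟩ := hBdeg p hp
      exact ⟨k, hk⟩
  have h := card_le_mul_pow_of_minimalPrimes (a := 0) he hD hg0 hg hBdeg rfl (by omega)
    (T.image 𝔭) (fun 𝔓 h𝔓 => by
      obtain ⟨x, hx, rfl⟩ := Finset.mem_image.mp h𝔓
      obtain ⟨F, hFx, hF⟩ := hiso x hx
      refine ⟨ker_lineSubst_mem_minimalPrimes_of_isolated (hT0 x hx) hG ?_ hFx T hT0 ?_, ?_⟩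
      · rintro p (rfl | hp)
        · exact hTg x hx
        · exact hTB x hx p hp
      · intro y hyG hyF
        exact hF y (hyG g (Set.mem_insert _ _)) (fun b hb => hyG b (Set.mem_insert_of_mem _ hb)) hyF
      · rw [Nat.zero_add]
        exact ringKrullDim_quotient_ker_lineSubst (hT0 x hx))
  rwa [show m - (0 + 1) - 1 = m - 2 by omega] at h

end Literature.RingTheory.MvPolynomial

end
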